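import Summits.Ventures.HodgeRepro.Tier3LemmaRNonvanishing
import Summits.Ventures.HodgeRepro.Tier3PullbackDictionary
import Summits.Ventures.HodgeRepro.Tier3LineCoefficients

/-!
# LEMMA R's non-vanishing MODEL-FREE: from `H¹(B_red)`, `H¹(B)` and the pull-back of the sum map to
«`e · m^* η ≠ 0` on every `σ`-line» — LEMMA-R-RESIDUE.md §5 as one theorem with no coordinate model in its statement

Blind re-derivation cell `pub-hodge-repro`, seat `t3-p4` (Tier 3, T3.5 for T3.4).  Target tree path
`lean/Summits/Ventures/HodgeRepro/Tier3LemmaRAbstract.lean`; imports the cell's `Tier3LemmaRNonvanishing` (the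
membership-level orbit theorem, `mem_reducedSet_mul_iff`), `Tier3PullbackDictionary` (the eigenbasis pair with
the pull-back relation, `map_baseChange_eq_pullLin_twistMap`) and `Tier3LineCoefficients` (its helper), hence `Tier3EigenDictionary`, `Tier3WedgeChain`,
`Tier3OrbitPullback` and night-1's `Night1ReducedPullback`.

WHAT THIS FILE STATES.  The three dictionaries of this seat (`Tier3EigenDictionary`: eigen-coordinates;
`Tier3PullbackDictionary`: `pullLin (twistMap cls tw)` = the pull-back `M`; night-1's `setDual` = the eigen-component)
are used INSIDE the proof to transport night-1's computation to the abstract side, so that the conclusion mentions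
only the abstract objects:

* The helper file `Tier3LineCoefficients` supplies the re-enumeration signs of the dual functionals, the naturality
  of the wedge base change, and night-1's pull-back computation for arbitrary enumerations of a `σ`-line.
* `basis_equiv_basisFun_tmul` — the canonical eigen-coordinate identification, named.
* **`exists_rational_class_repr_lineSet_ne_zero`** — LEMMA R's NON-VANISHING, MODEL-FREE.  Data: `K/F₀` finite
  Galois (`F/ℚ`); `V_red` with `K`-basis `ω : J → V_red` (`H¹(B_red, ℚ)`, one `F`-generator per factor);
  `V_B` with `K`-basis `ω′ : ι → V_B` (`H¹(B, ℚ)`, the `i`-th corner with the CM structure twisted by `tw i`); a face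
  `(cls, tw)` with `(cls, tw)` injective and `|ι| = 2k`; the pull-back `M : V_red → V_B` of the sum map,
  `M (c • ω_j) = Σ_{cls i = j} (tw i)⁻¹(c) • ω′_i`; the Galois action on `J × Gal(K/F₀)` by left multiplication.
  Conclusion: there are the eigenbases `e`, `e′`, base-change isomorphisms `Φ`, `Φ′` and wedge bases `E`, `E′`
  (with `(1 ⊗ M) e (j, x) = Σ_{cls i = j} e′ (i, x · tw i)`) such that for every `F₀`-subspace `W ≤ ⋀^{2k} V_red`
  containing the wedges of the reduced sets after base change (Pohlmann's lines — PRINTED, M1 p0003:L68–L82, the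
  only input left on paper) there is a NON-ZERO `η ∈ W` whose pull-back `⋀^{2k} M η` has a NON-ZERO coefficient on
  the eigen-wedge `E′_L` of EVERY `σ`-line `L = {(i, σ) : i ∈ ι}`.  With `η ∈ B^p(B_red)` this is §5's
  «`e · m^* η = Σ_U c_U Σ_σ (± w_σ) ≠ 0` on every `σ`-line of `W_F(B)`», and no kernel↔cohomology dictionary is
  needed to READ it: the statement is about `H¹(B_red)`, `H¹(B)`, `m^*` and the eigenlines of the CM actions.

HONESTY.  Linear algebra on the cell's own modules; no definition is introduced; nothing geometric is built.  What
stays on paper / in print: that `H¹(A_j, ℚ)` is free of rank one over `F` with the eigenline decomposition of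
`H¹ ⊗ ℂ` (D1 p0030:L23–L36), that the right-translated corner `A_{Φ · g}` is `A_Φ` with the CM structure twisted
by `g`, that the sum map's pull-back on `H¹` is the diagonal map `M` (S1: M2 Cor 5.6, M1 p0005:L38–L45, Künneth),
and Pohlmann's theorem for the hypothesis on `W`.  HC_CM is NOT proved by anyone in this repository.
-/

set_option autoImplicit false

open TensorProduct Finset

namespace HodgeRepro.Tier3

open HodgeRepro.RouteC HodgeRepro.CMHodgeOn

/-! ### §4 LEMMA R's non-vanishing, model-free -/

section LineSum

variable {G : Type*} [Group G] [DecidableEq G] [Fintype G] {ι J : Type*} [Fintype ι] [DecidableEq ι]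
  [Fintype J] [DecidableEq J]

/-- **The `σ`-line coefficient of the pull-back of a combination of coordinate wedges** (night-1's model,
`Tier3OrbitPullback.exists_sign_wedgeComponent_lineEnum_map_pullLin_sum` for the canonical enumerations): for
`(cls, tw)` injective, `L` enumerating the `σ`-line and `U` the reduced set `U_σ`,
`⟨e^*_L, ⋀^{2k} pullLin (twistMap cls tw) (Σ_s c_s • e_s)⟩ = c_U · ε` with `ε ∈ {1, −1}`. -/
theorem exists_sign_setDual_map_pullLin_sum_smul_coordWedgeOn [LinearOrder (J × G)] [LinearOrder (ι × G)]
    {cls : ι → J} {tw : ι → G} (hinj : Function.Injective fun i => (cls i, tw i)) {k : ℕ}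
    (e₀ : Fin (2 * k) ≃ ι) (σ : G) (L : Set.powersetCard (ι × G) (2 * k)) (hL : (L : Finset (ι × G)) = lineSet σ)
    (U : Set.powersetCard (J × G) (2 * k)) (hU : (U : Finset (J × G)) = reducedSet cls tw σ)
    (c : Set.powersetCard (J × G) (2 * k) → ℂ) :
    ∃ ε : ℂ, (ε = 1 ∨ ε = -1) ∧
      setDual (Set.powersetCard.ofFinEmbEquiv.symm L)
        (exteriorPower.map (2 * k) (pullLin (twistMap cls tw))
          (∑ s, c s • coordWedgeOn (2 * k) (Set.powersetCard.ofFinEmbEquiv.symm s))) = c U * ε := by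
  have himgL : Finset.univ.image (Set.powersetCard.ofFinEmbEquiv.symm L) = lineSet σ := by
    rw [setDual_sum_smul_coordWedgeOn.image_coe_ofFinEmbEquiv_symm, hL]
  obtain ⟨ε, hε, hval⟩ := exists_sign_setDual_map_pullLin_coordWedgeOn_of_image_eq hinj e₀ σ
    (Set.powersetCard.ofFinEmbEquiv.symm L).injective himgL
    (Set.powersetCard.ofFinEmbEquiv.symm U).injective
    (by rw [setDual_sum_smul_coordWedgeOn.image_coe_ofFinEmbEquiv_symm, hU])
  refine ⟨ε, hε, ?_⟩
  rw [map_sum, map_sum, Finset.sum_eq_single_of_mem U (Finset.mem_univ _)]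
  · rw [map_smul, map_smul, hval, smul_eq_mul]
  · intro s _ hs
    have himgs : Finset.univ.image (Set.powersetCard.ofFinEmbEquiv.symm s) ≠ reducedSet cls tw σ := by
      rw [setDual_sum_smul_coordWedgeOn.image_coe_ofFinEmbEquiv_symm, ← hU]
      intro h
      exact hs (Subtype.ext h)
    rw [map_smul, map_smul, setDual_map_pullLin_coordWedgeOn_eq_zero_of_image_ne
      (Set.powersetCard.ofFinEmbEquiv.symm L).injective himgL
      (Set.powersetCard.ofFinEmbEquiv.symm s).injective himgs, smul_zero]

end LineSum

section Canonical

variable {F₀ K : Type*} [Field F₀] [Field K] [Algebra F₀ K]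
variable {Vr : Type*} [AddCommGroup Vr] [Module F₀ Vr] [Algebra K ℂ]

/-- The canonical eigen-coordinate identification `1 ⊗ e p ↦ e_p` (the `Ψ` of
`Tier3EigenDictionary.exists_eigenCoordinates`, named). -/
theorem basis_equiv_basisFun_tmul {X : Type*} [Fintype X] [DecidableEq X] (e : Module.Basis X K (K ⊗[F₀] Vr))
    (p : X) :
    (e.baseChange ℂ).equiv (Pi.basisFun ℂ X) (Equiv.refl X) ((1 : ℂ) ⊗ₜ[K] e p) = coordVecOn p := by
  have h : (1 : ℂ) ⊗ₜ[K] e p = (e.baseChange ℂ) p := (Module.Basis.baseChange_apply ℂ e p).symm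
  rw [h, Module.Basis.equiv_apply, Pi.basisFun_apply, Equiv.refl_apply]
  rfl

end Canonical

section Abstract

variable {F₀ K : Type*} [Field F₀] [Field K] [Algebra F₀ K]
variable {Vr VB : Type*} [AddCommGroup Vr] [Module K Vr] [Module F₀ Vr] [IsScalarTower F₀ K Vr]
  [AddCommGroup VB] [Module K VB] [Module F₀ VB] [IsScalarTower F₀ K VB]
variable {J ι : Type*} [Fintype J] [DecidableEq J] [Fintype ι] [DecidableEq ι] [DecidableEq (K ≃ₐ[F₀] K)]
variable [FiniteDimensional F₀ K] [IsGalois F₀ K] [Algebra K ℂ]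

/-- **LEMMA R's non-vanishing, MODEL-FREE.**  Data: a finite Galois extension `K/F₀` (`F/ℚ`); `V_red` with its
`K`-basis `ω : J → V_red` (`H¹(B_red, ℚ)` with its `F`-generators, one per factor `A_j`); `V_B` with its `K`-basis
`ω′ : ι → V_B` (`H¹(B, ℚ)`, the `i`-th corner carrying the CM structure twisted by `tw i`); a face `(cls, tw)`
with `(cls, tw)` injective (twists pairwise distinct within a class) and `|ι| = 2k`; the pull-back
`M : V_red → V_B` of the sum map — `F₀`-linear, `M (c • ω_j) = Σ_{cls i = j} (tw i)⁻¹(c) • ω′_i`; and the action of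
`Gal(K/F₀)` on `J × Gal(K/F₀)` by left multiplication.  Then there are the eigenbases `e`, `e′`, the base-change
isomorphisms `Φ`, `Φ′` and the wedge bases `E`, `E′` of `K ⊗ ⋀^{2k} V_red`, `K ⊗ ⋀^{2k} V_B` with
`(1 ⊗ M) e (j, x) = Σ_{cls i = j} e′ (i, x · tw i)` such that, for every `F₀`-subspace `W ≤ ⋀^{2k} V_red` containing
the wedges of the reduced sets `U_σ` after base change (Pohlmann's lines — PRINTED, M1 p0003:L68–L82, the only
input left on paper), there is a NON-ZERO `η ∈ W` whose pull-back `⋀^{2k} M (η)` has a NON-ZERO coefficient on the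
eigen-wedge `E′_L` of EVERY `σ`-line `L = {(i, σ) : i ∈ ι}` of `K ⊗ ⋀^{2k} V_B`: «`e · m^* η ≠ 0` on every `σ`-line
of `W_F(B)`», with no coordinate model in the statement. -/
theorem exists_rational_class_repr_lineSet_ne_zero {k : ℕ}
    (cls : ι → J) (tw : ι → K ≃ₐ[F₀] K) (hinj : Function.Injective fun i => (cls i, tw i))
    (hcard : Fintype.card ι = 2 * k)
    (ω : Module.Basis J K Vr) (ω' : Module.Basis ι K VB) (M : Vr →ₗ[F₀] VB)
    (hM : ∀ (c : K) (j : J), M (c • ω j) = ∑ i ∈ univ.filter (fun i => cls i = j), ((tw i)⁻¹ c) • ω' i)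
    [LinearOrder (J × (K ≃ₐ[F₀] K))] [LinearOrder (ι × (K ≃ₐ[F₀] K))]
    [MulAction (K ≃ₐ[F₀] K) (J × (K ≃ₐ[F₀] K))]
    (hact : ∀ (σ x : K ≃ₐ[F₀] K) (j : J), σ • (j, x) = (j, σ * x)) :
    ∃ (e : Module.Basis (J × (K ≃ₐ[F₀] K)) K (K ⊗[F₀] Vr))
      (E : Module.Basis (Set.powersetCard (J × (K ≃ₐ[F₀] K)) (2 * k)) K (K ⊗[F₀] ⋀[F₀]^(2 * k) Vr))
      (Φ : K ⊗[F₀] ⋀[F₀]^(2 * k) Vr ≃ₗ[K] ⋀[K]^(2 * k) (K ⊗[F₀] Vr))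
      (e' : Module.Basis (ι × (K ≃ₐ[F₀] K)) K (K ⊗[F₀] VB))
      (E' : Module.Basis (Set.powersetCard (ι × (K ≃ₐ[F₀] K)) (2 * k)) K (K ⊗[F₀] ⋀[F₀]^(2 * k) VB))
      (Φ' : K ⊗[F₀] ⋀[F₀]^(2 * k) VB ≃ₗ[K] ⋀[K]^(2 * k) (K ⊗[F₀] VB)),
      (∀ (σ x : K ≃ₐ[F₀] K) (j : J), LinearMap.rTensor Vr σ.toLinearMap (e (j, x)) = e (j, σ * x)) ∧
      (∀ (σ x : K ≃ₐ[F₀] K) (i : ι), LinearMap.rTensor VB σ.toLinearMap (e' (i, x)) = e' (i, σ * x)) ∧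
      (∀ (x : K ≃ₐ[F₀] K) (j : J),
        LinearMap.lTensor K M (e (j, x)) = ∑ i ∈ univ.filter (fun i => cls i = j), e' (i, x * tw i)) ∧
      (∀ (c : K) (v : Fin (2 * k) → Vr),
        Φ (c ⊗ₜ[F₀] exteriorPower.ιMulti F₀ (2 * k) v) =
          c • exteriorPower.ιMulti K (2 * k) (fun i => (1 : K) ⊗ₜ[F₀] v i)) ∧
      (∀ (c : K) (w : Fin (2 * k) → VB),
        Φ' (c ⊗ₜ[F₀] exteriorPower.ιMulti F₀ (2 * k) w) =
          c • exteriorPower.ιMulti K (2 * k) (fun i => (1 : K) ⊗ₜ[F₀] w i)) ∧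
      (∀ s, Φ (E s) = exteriorPower.ιMulti_family K (2 * k) e s) ∧
      (∀ s, Φ' (E' s) = exteriorPower.ιMulti_family K (2 * k) e' s) ∧
      ∀ (W : Submodule F₀ (⋀[F₀]^(2 * k) Vr)),
        (∀ s : Set.powersetCard (J × (K ≃ₐ[F₀] K)) (2 * k),
          (∃ σ, (s : Finset (J × (K ≃ₐ[F₀] K))) = reducedSet cls tw σ) → E s ∈ W.baseChange K) →
        ∃ η ∈ W, η ≠ 0 ∧ ∀ (σ : K ≃ₐ[F₀] K) (L : Set.powersetCard (ι × (K ≃ₐ[F₀] K)) (2 * k)),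
          (L : Finset (ι × (K ≃ₐ[F₀] K))) = lineSet σ →
          E'.repr ((1 : K) ⊗ₜ[F₀] exteriorPower.map (2 * k) M η) L ≠ 0 := by
  classical
  -- the eigenbasis pair with the pull-back relation
  obtain ⟨e, e', he1, he2, he1', he2', hMe⟩ := exists_equivariant_eigenbasis_pullback ω ω'
    (fun b => ω.constr K fun j => b j • ω j) (fun b j => by rw [Module.Basis.constr_basis])
    (fun b => ω'.constr K fun i => b i • ω' i) (fun b i => by rw [Module.Basis.constr_basis])
    cls tw M hM
  have hequiv : ∀ (σ : K ≃ₐ[F₀] K) (i : J × (K ≃ₐ[F₀] K)),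
      LinearMap.rTensor Vr σ.toLinearMap (e i) = e (σ • i) := by
    rintro σ ⟨j, x⟩
    rw [hact, he1]
  obtain ⟨Φ, hΦ⟩ := exists_wedgeBaseChange (F₀ := F₀) (K := K) (V := Vr) (2 * k)
  obtain ⟨Φ', hΦ'⟩ := exists_wedgeBaseChange (F₀ := F₀) (K := K) (V := VB) (2 * k)
  have hE : ∀ s, Φ (((e.exteriorPower (2 * k)).map Φ.symm) s) = exteriorPower.ιMulti_family K (2 * k) e s := by
    intro s
    rw [Module.Basis.map_apply, LinearEquiv.apply_symm_apply, exteriorPower.basis_apply]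
  have hE' : ∀ s, Φ' (((e'.exteriorPower (2 * k)).map Φ'.symm) s) =
      exteriorPower.ιMulti_family K (2 * k) e' s := by
    intro s
    rw [Module.Basis.map_apply, LinearEquiv.apply_symm_apply, exteriorPower.basis_apply]
  refine ⟨e, (e.exteriorPower (2 * k)).map Φ.symm, Φ, e', (e'.exteriorPower (2 * k)).map Φ'.symm, Φ',
    he1, he1', hMe, hΦ, hΦ', hE, hE', ?_⟩
  intro W hPW
  -- the rational class with non-zero coefficients on the orbit of the reduced sets (Tier3LemmaRNonvanishing)
  have hcardU : ∀ σ : K ≃ₐ[F₀] K, (reducedSet cls tw σ).card = 2 * k := by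
    intro σ
    rw [card_reducedSet cls tw hinj σ, hcard]
  let P : Set (Set.powersetCard (J × (K ≃ₐ[F₀] K)) (2 * k)) :=
    {s | ∃ σ, (s : Finset (J × (K ≃ₐ[F₀] K))) = reducedSet cls tw σ}
  let U : (K ≃ₐ[F₀] K) → Set.powersetCard (J × (K ≃ₐ[F₀] K)) (2 * k) :=
    fun σ => ⟨reducedSet cls tw σ, Set.powersetCard.mem_iff.mpr (hcardU σ)⟩
  have hUP : ∀ σ, U σ ∈ P := fun σ => ⟨σ, rfl⟩
  have hmemU : ∀ (σ : K ≃ₐ[F₀] K) (p : J × (K ≃ₐ[F₀] K)), p ∈ U σ ↔ p ∈ reducedSet cls tw σ :=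
    fun _ _ => Iff.rfl
  have hP : ∀ (τ : K ≃ₐ[F₀] K), ∀ s ∈ P, ∃ s' ∈ P, ∀ p, p ∈ s' ↔ ∃ q ∈ s, τ • q = p := by
    rintro τ s ⟨σ, hs⟩
    refine ⟨U (τ * σ), hUP _, fun p => ?_⟩
    rw [hmemU, mem_reducedSet_mul_iff hact cls tw τ σ p]
    constructor
    · rintro ⟨q, hq, rfl⟩
      exact ⟨q, by rw [← Set.powersetCard.mem_coe_iff, hs]; exact hq, rfl⟩
    · rintro ⟨q, hq, rfl⟩
      exact ⟨q, by rw [← Set.powersetCard.mem_coe_iff, hs] at hq; exact hq, rfl⟩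
  obtain ⟨η, hηW, hη0, hcoef⟩ :=
    exists_rational_wedge_of_orbit_mem (2 * k) e hequiv Φ hΦ W P hP hPW (U 1) (hUP 1)
  have hcoefU : ∀ σ, ((e.exteriorPower (2 * k)).map Φ.symm).repr ((1 : K) ⊗ₜ[F₀] η) (U σ) ≠ 0 := by
    intro σ
    refine hcoef (U σ) ⟨σ, fun p => ?_⟩
    simp only [hmemU]
    have := mem_reducedSet_mul_iff hact cls tw σ 1 p
    rwa [mul_one] at this
  refine ⟨η, hηW, hη0, fun σ L hL => ?_⟩
  -- the two canonical eigen-coordinate models and the base changes of the wedge spaces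
  obtain ⟨Ψ, -, hΨ⟩ := exists_eigenCoordinates (fun b => ω.constr K fun j => b j • ω j) e he2
  obtain ⟨Ψ', -, hΨ'⟩ := exists_eigenCoordinates (fun b => ω'.constr K fun i => b i • ω' i) e' he2'
  obtain ⟨Φ₂, hΦ₂⟩ := exists_wedgeBaseChange (F₀ := K) (K := ℂ) (V := K ⊗[F₀] Vr) (2 * k)
  obtain ⟨Φ₂', hΦ₂'⟩ := exists_wedgeBaseChange (F₀ := K) (K := ℂ) (V := K ⊗[F₀] VB) (2 * k)
  obtain ⟨e₀⟩ : Nonempty (Fin (2 * k) ≃ ι) := ⟨(Fintype.equivFinOfCardEq hcard).symm⟩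
  -- the coefficient on `L` is read off the model of `B`
  have hD' := map_baseChange_tmul_eq_sum_smul_coordWedgeOn (2 * k) Φ' e' _ hE' Φ₂' hΦ₂' Ψ' (fun _ => 1)
    (fun p => by rw [hΨ', one_smul]) ((1 : K) ⊗ₜ[F₀] exteriorPower.map (2 * k) M η)
  simp only [Finset.prod_const_one, mul_one] at hD'
  have hcoefL : setDual (Set.powersetCard.ofFinEmbEquiv.symm L)
      (exteriorPower.map (2 * k) (Ψ' : ℂ ⊗[K] (K ⊗[F₀] VB) →ₗ[ℂ] (ι × (K ≃ₐ[F₀] K) → ℂ))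
        (Φ₂' (LinearMap.baseChange ℂ (Φ' : K ⊗[F₀] ⋀[F₀]^(2 * k) VB →ₗ[K] ⋀[K]^(2 * k) (K ⊗[F₀] VB))
          ((1 : ℂ) ⊗ₜ[K] ((1 : K) ⊗ₜ[F₀] exteriorPower.map (2 * k) M η))))) =
      algebraMap K ℂ (((e'.exteriorPower (2 * k)).map Φ'.symm).repr
        ((1 : K) ⊗ₜ[F₀] exteriorPower.map (2 * k) M η) L) := by
    rw [hD', setDual_sum_smul_coordWedgeOn]
  -- naturality: the model class of `1 ⊗ ⋀M η` is `⋀ pullLin (twistMap)` of the model class of `1 ⊗ η`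
  have hN1 : (Φ' : K ⊗[F₀] ⋀[F₀]^(2 * k) VB →ₗ[K] ⋀[K]^(2 * k) (K ⊗[F₀] VB)) ∘ₗ
        LinearMap.baseChange K (exteriorPower.map (2 * k) M) =
      exteriorPower.map (2 * k) (LinearMap.baseChange K M) ∘ₗ
        (Φ : K ⊗[F₀] ⋀[F₀]^(2 * k) Vr →ₗ[K] ⋀[K]^(2 * k) (K ⊗[F₀] Vr)) :=
    LinearMap.ext fun z => wedgeBaseChange_naturality (2 * k) Φ hΦ Φ' hΦ' M z
  have hN3 : (Ψ' : ℂ ⊗[K] (K ⊗[F₀] VB) →ₗ[ℂ] (ι × (K ≃ₐ[F₀] K) → ℂ)) ∘ₗ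
        LinearMap.baseChange ℂ (LinearMap.baseChange K M) =
      pullLin (twistMap cls tw) ∘ₗ (Ψ : ℂ ⊗[K] (K ⊗[F₀] Vr) →ₗ[ℂ] (J × (K ≃ₐ[F₀] K) → ℂ)) :=
    LinearMap.ext fun z => map_baseChange_eq_pullLin_twistMap cls tw M e e' hMe Ψ hΨ Ψ' hΨ' z
  have hnat : exteriorPower.map (2 * k) (Ψ' : ℂ ⊗[K] (K ⊗[F₀] VB) →ₗ[ℂ] (ι × (K ≃ₐ[F₀] K) → ℂ))
        (Φ₂' (LinearMap.baseChange ℂ (Φ' : K ⊗[F₀] ⋀[F₀]^(2 * k) VB →ₗ[K] ⋀[K]^(2 * k) (K ⊗[F₀] VB))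
          ((1 : ℂ) ⊗ₜ[K] ((1 : K) ⊗ₜ[F₀] exteriorPower.map (2 * k) M η)))) =
      exteriorPower.map (2 * k) (pullLin (twistMap cls tw))
        (exteriorPower.map (2 * k) (Ψ : ℂ ⊗[K] (K ⊗[F₀] Vr) →ₗ[ℂ] (J × (K ≃ₐ[F₀] K) → ℂ))
          (Φ₂ (LinearMap.baseChange ℂ (Φ : K ⊗[F₀] ⋀[F₀]^(2 * k) Vr →ₗ[K] ⋀[K]^(2 * k) (K ⊗[F₀] Vr))
            ((1 : ℂ) ⊗ₜ[K] ((1 : K) ⊗ₜ[F₀] η))))) := by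
    obtain ⟨y, hy⟩ : ∃ y : ℂ ⊗[K] (K ⊗[F₀] ⋀[F₀]^(2 * k) Vr), y = (1 : ℂ) ⊗ₜ[K] ((1 : K) ⊗ₜ[F₀] η) := ⟨_, rfl⟩
    have h1 : (1 : ℂ) ⊗ₜ[K] ((1 : K) ⊗ₜ[F₀] exteriorPower.map (2 * k) M η) =
        LinearMap.baseChange ℂ (LinearMap.baseChange K (exteriorPower.map (2 * k) M)) y := by
      rw [hy, LinearMap.baseChange_tmul, LinearMap.baseChange_tmul]
    have hB := LinearMap.congr_fun (congrArg (LinearMap.baseChange ℂ) hN1) y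
    rw [LinearMap.baseChange_comp, LinearMap.baseChange_comp, LinearMap.comp_apply, LinearMap.comp_apply] at hB
    have hC := wedgeBaseChange_naturality (2 * k) Φ₂ hΦ₂ Φ₂' hΦ₂' (LinearMap.baseChange K M)
      (LinearMap.baseChange ℂ (Φ : K ⊗[F₀] ⋀[F₀]^(2 * k) Vr →ₗ[K] ⋀[K]^(2 * k) (K ⊗[F₀] Vr)) y)
    have hD := map_map_eq_of_comp_eq (2 * k) (LinearMap.baseChange ℂ (LinearMap.baseChange K M))
      (Ψ' : ℂ ⊗[K] (K ⊗[F₀] VB) →ₗ[ℂ] (ι × (K ≃ₐ[F₀] K) → ℂ))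
      (Ψ : ℂ ⊗[K] (K ⊗[F₀] Vr) →ₗ[ℂ] (J × (K ≃ₐ[F₀] K) → ℂ)) (pullLin (twistMap cls tw)) hN3
      (Φ₂ (LinearMap.baseChange ℂ (Φ : K ⊗[F₀] ⋀[F₀]^(2 * k) Vr →ₗ[K] ⋀[K]^(2 * k) (K ⊗[F₀] Vr)) y))
    rw [h1, ← hy, hB, hC, hD]
  -- the model class of `1 ⊗ η` on the coordinate wedges, and its `σ`-line component
  have hD := map_baseChange_tmul_eq_sum_smul_coordWedgeOn (2 * k) Φ e _ hE Φ₂ hΦ₂ Ψ (fun _ => 1)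
    (fun p => by rw [hΨ, one_smul]) ((1 : K) ⊗ₜ[F₀] η)
  simp only [Finset.prod_const_one, mul_one] at hD
  obtain ⟨ε, hε, hval⟩ := exists_sign_setDual_map_pullLin_sum_smul_coordWedgeOn hinj e₀ σ L hL (U σ) rfl
    (fun s => algebraMap K ℂ (((e.exteriorPower (2 * k)).map Φ.symm).repr ((1 : K) ⊗ₜ[F₀] η) s))
  rw [hnat, hD, hval] at hcoefL
  intro h0
  rw [h0, map_zero] at hcoefL
  refine mul_ne_zero ((map_ne_zero (algebraMap K ℂ)).mpr (hcoefU σ)) ?_ hcoefL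
  rcases hε with rfl | rfl <;> simp

end Abstract

end HodgeRepro.Tier3
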